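import Mathlib
import HarnessLib
import HarnessLib.Audit
import Summits.ABC.Statement
import Literature.NumberTheory.DiophantineGeometry.Conductor
import Literature.NumberTheory.DiophantineGeometry.MinimalDiscriminant
import HarnessLib.Audit.Status.Attr

/-!
Route: TwoTorsionFieldEconomy

# Route TwoTorsionFieldEconomy — Szpiro exponent 3/4 on the one-rational-2-torsion class via
d-uniform quadratic unit equations

CLASS THEOREM, NOT abc, NOT A-PS, no rung proved: on the coprime one-rational-2-torsion class 𝒯 = {W
= [0,a,0,b,0] : a,b ∈ ℤ, gcd(a,b)=1, b(a²−4b) ≠ 0} (all sign patterns, real and imaginary fields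
alike) it suffices to show the rad(a)-FREE field-economy bound X1 = `QuadraticFieldEconomyBound`:
log max(|b|,|a²−4b|) ≤ κ_ε·rad(b(a²−4b))^ε·rad(a²−4b)^{1/2}·min(rad b, rad(a²−4b)). With the shared
two-torsion dictionary (stmt-ABC-23398, proved) this gives the target `TwoTorsionClassEpsShape`:
log|Δ_min(W)| ≤ C_ε·N_W^{3/4+ε} on 𝒯 — below the all-E record exponent 1 (Murty–Pasten) on an
infinite class, incomparable with the Gaussian sub-class claim 2/3 (route-ABC-GaussianTwoDivision
covers only a²+m²=4b over the FIXED field ℚ(i)). `closes` reaches `_root_.ABC` only through the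
declared residual `TwoTorsionResidual` (abc given the class theorem), booked so the class theorem
has a home; to be re-targeted to `Summit.ABC.Harvest.SzpiroExponentBelowOne` off-class once that
alternative closer is registered (rq119). Realises card two-torsion-field-economy.
Lean: `QuadraticFieldEconomyBound → TwoTorsionDictionary → FieldEconomyPayoff → TwoTorsionResidual →
_root_.ABC`

## Assembly
Pure logic: `closes (h₁ : QuadraticFieldEconomyBound) (h₂ : TwoTorsionDictionary) (h₃ :
FieldEconomyPayoff) (h₄ : TwoTorsionResidual) : _root_.ABC := h₄ (h₃ h₁ h₂)`. Load-bearing open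
cruxes: X1 (rank 2) and the declared residual (rank 3); the dictionary is closed (★), the payoff
provable now. HONESTY: no summit and no rung is proved by this line; the mathematics of the line
ends at the class theorem `TwoTorsionClassEpsShape`; typed ≠ proved.

Rationale: WHY THIS LINE. Mechanism (extremal-example mining, director key IDEA-OPPOSITE-EXTREMAL: «assume the
obstruction is extremal and look at it»): over K = ℚ(√m), m = a²−4b, the 2-division abscissae e± =
(−a±√m)/2 satisfy e₊ − e₋ = √m, e₊e₋ = b, so e₊ + (−e₋) + (−√m) = 0 is a three-term S-unit equation
with pairwise coprime S-integral terms supported on the primes of 2bm — rad(a) never enters (the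
Gaussian dictionary with i ↦ √m). The recorded obstruction to letting K vary (idea-1 barrier note
B-LFL×DIVFIELD in route-ABC-GaussianTwoDivision: «uniformity costs |d_K|^{1/2+ε} on top of N^{2/3}:
blocked») is wrong on two counts that only the extremal (maximally ramified) fields display: (i)
RAMIFICATION NETTING — the primes of d_K are exactly the odd-exponent primes of m and they count p¹,
not p², in the norm radical, and |d_K| ≤ 8·rad(m); (ii) the P′-FORM — Le Fourn's bound
(arXiv:1812.06306 = doi:10.2140/ant.2020.14.785 Thm 1.4; restated [corpus:paper:arxiv-1901.11289
p.3, Győry 2019 Thm 3]) is linear in the THIRD largest prime norm of S, and since the b-primes split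
into conjugate pairs this is ≤ min(P(b),P(m)); with the S-regulator bound R_S ≤ h_K R_K ∏ log N𝔭
([corpus:paper:arxiv-1901.11289 p.8 Lemma 1] = Bugeaud–Győry 1996 Lemma 3,
doi:10.4064/aa-74-1-67-80) and h_K R_K ≪ |d_K|^{1/2} log|d_K| the field cost is ONE factor
|d_K|^{1/2+ε}, and rad(m)^{1/2}·min(rad b, rad m) ≤ rad(bm)^{3/4}: net exponent 3/4 < 1. What is
genuinely open is isolated by the same reading: Le Fourn's constant is c₁(d,s) = (16ds)^{2(s+3)} and
«the appearance of s^{2s} is due to Lemma 2» ([corpus:paper:arxiv-1901.11289 p.4]; Lemma 2 = a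
fundamental system of S-units with ∏h(ε_i) ≤ ((s−1)!)²/(2^{s−2}d^{s−1})·R_S, p.8), while Győry–Yu's
s^s-free Theorem 2 pays 𝓡^{t+5} = max(h_K, c R_K)^{t+5} instead (p.3); Scoones
(doi:10.1112/mtk.12230 §5 p.14, §6 p.15) records exactly this dichotomy and retreats to the Hilbert
class field (non-uniform in K). For s ~ 2ω(N) ~ log N/log log N, s^{2s} is N^{4+o(1)} and 𝓡^{t} is
N^{Θ(t)}: so the ONE missing input is a ROUND S-UNIT FRAME — s−1 multiplicatively independent
S-units of the quadratic field with ∏ heights ≤ C^s·R_S (Minkowski's second theorem gives s!·C^s·R_S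
for any lattice; equality-type C^s holds for K = ℚ and for h_K = 1 imaginary quadratic, which is why
Stewart–Yu over ℚ and the Gaussian line see no such loss). That is an input from the geometry of
numbers / zero-sum combinatorics of the class group (short signed relations among the classes [𝔭],
Davenport-constant style, plus Dirichlet balancing of the real-quadratic unit), a technique class
not in play on this ladder (cone: LFL, modular degree, Shimura curves, Runge). Imported:
Baker–Yu–Matveev LFL over number fields (Le Fourn/Győry–Yu), Brauer–Siegel/Louboutin upper bounds
for h_K R_K, Tate's algorithm (dictionary), Minkowski II. New relative to the listed routes:
GaussianTwoDivision (fixed ℚ(i), h_K = 1, exponent 2/3 on the thin sub-class a²+m²=4b),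
AntisymmetricTwoTorsion (PSM rad(a)-free engine: sub-exponential but with the trace defect
12·log(1+|a|) and only for antisymmetric signs), CubicResolventAllowance (index allowance toward
A-PS, unlicensed): none varies the field, none nets ramification, none names the S-unit-frame
roundness; the symmetric-sign sub-class (b > 0, a² − 4b > 0: real quadratic K) had NO bound below
exponent 1 on the ladder. Negatives index (stmt-ABC-1205 BelyiSqueeze, stmt-ABC-1689
GlobalQuasiLogDerivative): not touched (no Belyi maps, no derivations).

RANKED CRUXES. #0 TwoTorsionClassEpsShape (target) — for every ε > 0 there is C such that for all
coprime integers a, b with b(a²−4b) ≠ 0 and every elliptic W/ℚ equal to [0,a,0,b,0]: log|Δ_min(W)| ≤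
C·N_W^{3/4+ε}. A class theorem (NOT abc, NOT A-PS, NOT the all-E rung SzpiroExponentBelowOne). (why
it might fail: it fails only if X1 fails; abc (indeed Szpiro 6+ε) implies it with exponent ε, so a
failure would refute abc on the class — the risk is unprovability by the field-economy mechanism
(s^{2s}), not falsity.) [arXiv:1812.06306, arXiv:1901.11289, doi:10.1112/mtk.12230,
PastenShimura2024]
#2 QuadraticFieldEconomyBound (crux) — X1, the ℤ-shadow of the d-uniform quadratic P′-form with
S-regulator cost and ramification netting: for every ε > 0 there is κ with log max(|b|, |a²−4b|) ≤ κ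
· rad(b(a²−4b))^ε · rad(a²−4b)^{1/2} · min(rad b, rad(a²−4b)) for all coprime integers a, b with
b(a²−4b) ≠ 0 (rad = |UniqueFactorizationMonoid.radical|; no rad(a)). Genesis: Le Fourn Thm 1.4 over
K = ℚ(√(a²−4b)) applied to e₊ + (−e₋) + (−√m) = 0 [P′_S ≤ min(P(b),P(m)) ≤ min(rad b, rad m)] × [R_S
≤ h_K R_K ∏ log N𝔭 ≤ |d_K|^{1/2+ε}·rad(bm)^{ε}] × [|d_K| ≤ 8 rad(m)] × [C^s in place of
(32s)^{2s+6}: the round-frame input K1a, filed informally after open]. abc-implied with room (abc ⇒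
log max ≤ (2+ε)·log rad(bm) + C on the class, since a enters squared); A-PS-implied; strictly weaker
than either. [difficulty: XL] (why it might fail: the S-unit lattice of ℚ(√m) with class group of
exponent ~h_K and few split primes per dyadic scale may have successive-minima product ≫ C^s·R_S
(Minkowski allows s!·R_S ≈ N^{1+o(1)}·R_S), leaving Le Fourn's (32s)^{2s+6} essentially sharp for
this method.) [arXiv:1812.06306, arXiv:1901.11289, doi:10.4064/aa-74-1-67-80, doi:10.4064/aa123-1-2,
doi:10.1112/mtk.12230, StewartYu2001]
#3 TwoTorsionResidual (crux) — DECLARED RESIDUAL (abc-strength by construction, never staffed as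
mathematics of this line): abc given the class theorem — i.e. abc off (and on) the class beyond
exponent 3/4. Booked so that `closes` reaches the registered Statement decl; to be narrowed to
`SzpiroExponentBelowOne` off 𝒯 when that closer is registered. [deps: TwoTorsionClassEpsShape]
[difficulty: open-problem] (why it might fail: it is abc-hard (equivalent to abc given the class
theorem); it fails exactly if abc fails — declared residual, not a claim of this line.)
[PastenShimura2024, Literature.Abc.ABCConjecture]
#9 TwoTorsionDictionary (support) — BY-NAME support = shared item stmt-ABC-23398 (proved,
`Summit.ABC.ABC.Theorems.twoTorsionDictionary_proof`): for coprime a, b with b(a²−4b) ≠ 0 and W =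
[0,a,0,b,0] elliptic: |Δ_min(W)| ≤ |16 b²(a²−4b)| and rad(b(a²−4b)) ∣ 2·N_W (Tate's algorithm away
from 2). [difficulty: provable-now] [Silverman2009, stmt-ABC-23398]
#9 FieldEconomyPayoff (support) — X1 + dictionary ⇒ target: log|Δ_min| ≤ log 16 + 2 log|b| + log|m|
≤ 3·log max(|b|,|m|) + 3 ≤ 3κ·rad(bm)^ε·rad(m)^{1/2}·min(rad b, rad m) + 3, and rad(m)^{1/2}·min(rad
b, rad m) ≤ (rad b · rad m)^{3/4} = rad(bm)^{3/4} (coprimality; two cases rad b ≤ rad m, rad m ≤ rad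
b), rad(bm) ≤ 2 N_W; constants absorbed using N_W ≥ 1. Elementary real-analysis bookkeeping
(S/M-sized in Lean: rpow monotonicity, radical of a coprime product). [difficulty: provable-now]
[stmt-ABC-23398, Silverman2009]

TWO-LAYER PLAN. X1 ⇐ K1a ∧ K1b ∧ K1c (foreseen glued split, filed informally at open, typed when a
prover asks): K1a `RoundSUnitFrames` — for K quadratic and S ⊇ S_∞ with t finite places there are
s−1 multiplicatively independent S-units η_i with ∏ h(η_i) ≤ C^s · R_S (absolute C; a
non-fundamental system of bounded index is allowed — the index only enters log B); K1b
`UniformQuadraticLeFourn` — Le Fourn's Thm 1.4 / Győry 2019 Thm 1 for α x + β y = 1 over K = ℚ(√m)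
run on the frame of K1a: max h ≤ C^s · P′_S · (1 + log⁎R_S/log⁎P′_S) · R_S · H, d = 2 explicit, no
other dependence on K; K1c `NettedDictionary` — P′_S ≤ min(P(b), P(m)), R_S ≤ h_K R_K ∏ log N𝔭 ≤ c_ε
|d_K|^{1/2} (log|d_K|) rad(2bm)^{ε}, |d_K| ≤ 8·rad(m), C^s·∏ log N𝔭 ≤ rad(2bm)^{ε} (provable-now
bookkeeping mod Louboutin's bound as a cited fact). Extension E1 (not filed): PARTNER-FIELD CHOICE —
the 2-isogenous W′ = [0,−2a,0,a²−4b,0] has field ℚ(√b); taking the better of the two fields replaces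
rad(m)^{1/2} by min(rad b, rad m)^{1/2} (same worst case 3/4, better constants on skewed pairs).
Extension E2: the Gaussian sub-class (m = −n²) inherits the P′-form: exponent 1/2 instead of 2/3 for
route-ABC-GaussianTwoDivision (offered to abc-idea-1, not filed here).

KILL CRITERIA. Refutation of X1 as typed (a coprime pair (a,b) family with log
max(|b|,|a²−4b|)/[rad(m)^{1/2}·min(rad b, rad m)] unbounded for some fixed ε-power budget) closes
the route `refuted:QuadraticFieldEconomyBound` — note such a family would also refute abc on the
class unless min(rad b, rad m)·rad(m)^{1/2} ≪ log-scale there, so the realistic kill is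
METHOD-LEVEL: a proof (or PARI evidence, see Cheapest falsifier) that quadratic S-unit lattices have
successive-minima product ≥ s^{c s}·R_S infinitely often ⇒ K1a dead ⇒ pivot to the bounded-ω
sub-class theorem (in print modulo porting: exponent 3/4 on {W ∈ 𝒯 : ω(N_W) ≤ k}) and retire the
all-𝒯 claim as `exhausted`. Proved elsewhere that moots it: SzpiroExponentBelowOne with α ≤ 3/4 for
all E (none in sight), or A-PS.

NOT DECOMPOSED YET. The number-field statements K1a/K1b/K1c are deliberately NOT typed at open
(Mathlib has `IsDedekindDomain.HeightOneSpectrum`, `Set.integer`/`Set.unit` S-integers and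
`NumberField.Units.regulator`, but no Weil height API on 𝓞_K-elements convenient for ∏ h(η_i);
typing them is a half-day job done when a prover claims X1). Constants (Louboutin's h_K R_K ≤ (e/2)…
|d|^{1/2} log|d|), the non-minimality-at-2 bookkeeping (inside the proved dictionary), and the split
of X1 by sign of m (real vs imaginary K: the real case needs the Dirichlet-balanced unit inside K1a)
are layer-2.

CHEAPEST FALSIFIER. PARI/GP instrument ENG-SUNIT-ROUND (proposed row; kit job to be submitted by
this seat or the desk): for imaginary K = ℚ(√−d) with large cyclic class group (d prime ≡ 7 mod 8,
h_K ~ √d) and for real K = ℚ(√d) with large regulator, S = the first t split primes (t = 4…40):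
`bnfinit`, `bnfsunit` → log-height Gram data → LLL → ρ(K,S) := ∏ h(η_i)/R_S; the line predicts log ρ
= O(s); growth like s·log s (tracking ((s−1)!)²) kills K1a for this method. Second cheap check
(lookup, done): is a d-uniform polynomial-in-|d_K| S-unit bound with C^s in print? — no: Le Fourn
has s^{2s} [corpus:paper:arxiv-1901.11289 p.4], Győry–Yu Thm 2 has 𝓡^{t+5} [ibid. p.3], Scoones
passes to the Hilbert class field [corpus:paper:doi-10-1112-mtk-12230 p.14–15], Győry's base-field
abc bound has an inexplicit constant c(d, Δ_K) [ibid. p.15].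

NUMBERS. Record all-E exponent α = 1 (Murty–Pasten 2013 Thm 7.1: log|Δ| < 1.2 N log N + 93;
`SzpiroEpsShape 1`); Frey/full-2-torsion class: 1/3 (Stewart–Yu 2001); Gaussian sub-class: 2/3
claimed (route-ABC-GaussianTwoDivision, open crux stmt-ABC-23401); this line: 3/4 on all of 𝒯. Le
Fourn/Győry constants: c₁(d,s) = (16ds)^{2(s+3)}; c₁₀ = ((s−1)!)²/(2^{s−2}d^{s−1}); R_K ∏ log N𝔭 ≤
R_S ≤ R_K h_K ∏ log N𝔭. Worst case of the netted bound: rad b = rad m = (2N)^{1/2} ⇒ N^{3/4}.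
Szpiro-ratio record curves with a rational 2-torsion point lie in 𝒯 up to the gcd(a,b)=1
normalisation (calibration only; exponential shapes are not floored by [ecdata]).

DEFINITION REQUESTS. None at open. Wanted later (two-layer plan): a Weil-height-on-𝓞_K helper and an
`SUnitFrame` notion under `Summits/ABC/ABC/Theorems` (posited object: a finite multiplicatively
independent family of S-units with its height product), and the cite facts `LeFourn2020_thm_1_4`,
`BugeaudGyory1996_lemma_3` (S-regulator bound), `Louboutin_hR_upper` under
Literature/NumberTheory/DiophantineGeometry.

Novelty: Searches (2026-08-28): lit search "Győry Yu S-unit equations decomposable form bounds regulator" (6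
local: arXiv:1901.11289 held, Bugeaud–Győry 1996 held); lit search --hybrid "S-unit equation bound
third largest prime regulator Le Fourn Runge Baker" (Evertse–Győry 2015 book pp.64–90,
Baker–Wüstholz 2007); lit search "tubular approaches Baker method" (Le Fourn arXiv:1812.06306;
Scoones doi:10.1112/mtk.12230 held, read §5–6); lit galaxy search "S-unit equation|unit equations"
--star pdf (6 hits, Pasten 2312.03566 only relevant); tree: rg SzpiroExponentBelowOne /
TwoTorsionDictionary / GaussianTwoDivision / AntisymmetricTwoTorsion (read); ledger negatives
--problem ABC (2 entries, unrelated).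
Nearest prior art found: Le Fourn 2020 Thm 1.4 (arXiv:1812.06306) and Győry 2019 Thm 1
[corpus:paper:arxiv-1901.11289 p.3–4] (P′-form S-unit bounds, constants s^{2s} resp. 𝓡^{t+4});
Scoones 2023 Thm 3 and §5–6 [corpus:paper:doi-10-1112-mtk-12230 p.14–15] (N_S^{1/3}-type abc over a
FIXED number field via the Hilbert class field; base-field version with inexplicit c(d,Δ_K));
in-tree: route-ABC-GaussianTwoDivision (fixed ℚ(i), 2/3), route-ABC-AntisymmetricTwoTorsion (PSM
trace-defect engine), barrier note B-LFL×DIVFIELD (idea-1).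
Delta: nobody lets the quadratic field vary with the curve and nets the field cost against
ramification and the conjugate-pair P′ — doing so turns «blocked by |d_K|^{1/2}» into exponent 3/4
on the whole one-2-torsion class and isolates the single missing input as a g  [refs: 10.1112/mtk.12230, 1901.11289, 1812.06306, doi:10.1112/mtk.12230, paper:arxiv-1901.11289, paper:doi-10-1112-mtk-12230]

Barriers (technique_class: baker-linear-forms, geometry-of-numbers, tate-algorithm): - technique_class: baker-linear-forms, geometry-of-numbers, tate-algorithm
- Literature.Barriers.ABC.BakerMethodBounds: inside the class and respecting the cap — the output is
an exponential ε-shape (exponent 3/4 of the radical inside the exponential), never polynomial abc;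
the barrier caps LFL at such shapes and this line claims nothing beyond
[Literature/Barriers/ABC/BakerMethodBounds.lean; corpus: Baker–Wüstholz 2007 pp.38–41].
- Literature.Barriers.ABC.EpsilonCannotBeDropped: not engaged — every statement carries ε / free
constants; no ε = 0 claim.
- Literature.Barriers.ABC.SzpiroEpsilonCannotBeDropped: not engaged — exponent 3/4+ε with free C(ε),
far above the 6 of the barrier.
- Literature.Barriers.ABC.UniformABCDiscriminantSharp: relevant in spirit (uniform abc over number
fields must lose a discriminant factor): the line PAYS |d_K|^{1/2+ε} explicitly and nets it; it does
not claim discriminant-free uniformity.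
- B-LFL×DIVFIELD (planner note, route-ABC-GaussianTwoDivision): evaded — ramification netting +
P′-form; the note's accounting (|d_K|^{1/2}·N^{2/3}) double-counts ramified primes and uses the
N_S^{1/3} form.
- B-UNIF-S / w2 (uniformity in the number of places; Mersenne wall): this IS where the open crux
sits (s^{2s}); the bet is that S-unit lattices of quadratic fields are C^s-round (true for ℚ and h_K
= 1 imaginary quadratic; Minkowski gives s!); the Mersenne family (1, 2ⁿ−1, 2ⁿ) is not in 𝒯's image
in a way that forces polylog radicals (X1 is abc-implied on 𝒯)

Novelty grade: new-combination — critic abc-iut-crit-B g1 (novelty column, concurring with idea-crit-6 g2 verdict 05:03:23Z PASS-WITH-PRICE): NEW-COMBINATION. Load-bearing lever = the 2-division-field S-unit equation e+ - e- = sqrt(m) attacked by LFL / S-unit height bounds; PRIOR USE ON THIS PROBLEM: route-ABC-GaussianTwoDivision ( (refuter refuter-abc-iut-crit-B-g1-0, 2026-08-28T05:05:16Z; prior: Summit.ABC.ABC.Theses.GaussianTwoDivision.GaussianNormTripleBound, Summit.ABC.ABC.Theses.GaussianTwoDivision.GaussianClassEpsShape, Summit.ABC.ABC.Theses.GaussianTwoDivision.TwoTorsionDictionary,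 doi:10.1215/S0012-7094-01-10815-8, doi:10.4064/aa123-1-2, abc-idea-1 barrier note B-LFL×DIVFIELD (REDUCTION-CENSUS v2.14))

History (route lifecycle, newest last):
- 2026-08-28T05:15:30Z · rev 1: restated QuadraticFieldEconomyBound (stmt-ABC-25769) — restate X1 1:1 (unclaimed, route 30 min old): sound two-field form rad(bm)^{3/4+ε}; old form over-claimed where rad(a²−4b) ≪ rad(b) (m = −7 family: exponent 0⁺ (planner-abc-idea-2-g2-0)
- 2026-08-28T06:42:27Z · rev 2: dropped stmt-ABC-26094 — drop the unrendered wanted-item 26094 (FewPrimesFieldEconomy added via workitem add, never rendered); re-filed verbatim as a split child of QuadraticFieldEconom (planner-abc-idea-2-g2-0)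

sub-problem: ABC · status: draft · opened planner-abc-idea-2-g2-0 2026-08-28T04:56:10Z · rev 3 · ledger route-ABC-TwoTorsionFieldEconomy
GENERATED by the gate from the ledger (D-0016/17). Provers cite these decls: `theorem foo : Summit.ABC.ABC.Theses.TwoTorsionFieldEconomy.<Decl> := …` in Summits/ABC/ABC/Theorems/<Name>.lean.
-/

namespace Summit.ABC.ABC.Theses.TwoTorsionFieldEconomy

open scoped BigOperators Topology Manifold Classical MeasureTheory ProbabilityTheory Matrix InnerProductSpace ComplexConjugate ContinuousMap
open Filter Set Function TopologicalSpace MeasureTheory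

attribute [summit_statement] _root_.ABC

open Literature.Abc

/-- item stmt-ABC-25768 · target · rank 0 · open · by planner
why it might fail: it fails only if X1 fails; abc (indeed Szpiro 6+ε) implies it with exponent ε, so a failure would refute abc on the class — the risk is unprovability by the field-economy mechanism (s^{2s}), not falsity.
sources: arXiv:1812.06306, arXiv:1901.11289, doi:10.1112/mtk.12230, PastenShimura2024
[target] for every ε > 0 there is C such that for all coprime integers a, b with b(a²−4b) ≠ 0 and
every elliptic W/ℚ equal to [0,a,0,b,0]: log|Δ_min(W)| ≤ C·N_W^{3/4+ε}. A class theorem (NOT abc,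
NOT A-PS, NOT the all-E rung SzpiroExponentBelowOne). -/
@[route_item "route-ABC-TwoTorsionFieldEconomy"]
def TwoTorsionClassEpsShape : Prop :=
  ∀ ε : ℝ, 0 < ε → ∃ C : ℝ, ∀ a b : ℤ, IsCoprime a b → b ≠ 0 → a ^ 2 - 4 * b ≠ 0 → ∀ (W : WeierstrassCurve ℚ) [W.IsElliptic], W = ⟨0, (a : ℚ), 0, (b : ℚ), 0⟩ → Real.log (W.minimalDiscriminantNorm ℤ : ℝ) ≤ C * (W.conductorNorm ℤ : ℝ) ^ (3 / 4 + ε : ℝ)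

-- earlier QuadraticFieldEconomyBound (stmt-ABC-25769, replaced 2026-08-28T05:15:30Z -> stmt-ABC-25825): retired by None — ∀ ε : ℝ, 0 < ε → ∃ κ : ℝ, ∀ a b : ℤ, IsCoprime a b → b ≠ 0 → a ^ 2 - 4 * b ≠ 0 → Real.log (max (|(b : ℝ)|) (|(a : ℝ) ^ 2 - 4 * (b : ℝ)|)) ≤ κ * (((UniqueFactorizationMonoid.radical (b * (a ^ 2 - 4 * b))).natAbs : ℕ) : ℝ) ^ (ε : ℝ) * (((UniqueFactorizationMonoid.radical (a ^ 2 - 4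
/-- item stmt-ABC-25825 · crux · rank 2 · SPLIT (gen 1) into FewPrimesFieldEconomy, ManyPrimesFieldEconomy + glue QuadraticFieldEconomyBoundGlue · direct attempts still welcome (low priority) · by planner
why it might fail: K1a (C^s-round S-unit frames in quadratic fields) may fail for class groups of high 2-rank (kit j299244: LLL defect^(1/n) ≤ 1.73 up to n = 80, finite evidence); the P′-form factor (1+log*R_S/log*P′) and Louboutin h_K R_K ≪ √d·log d must stay inside N^ε.
sources: arXiv:1812.06306, arXiv:1901.11289, doi:10.1112/mtk.12230
[crux, restated 1:1 before any claim] TWO-FIELD ECONOMY in ℤ-shadow form: for coprime a, b with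
b(a²−4b) ≠ 0, log max(|b|,|a²−4b|) ≤ κ_ε·rad(b(a²−4b))^{3/4+ε}. Mechanism (registered skeleton
Lines/birth.lean v2): the 3-term S-unit equation e₊ − e₋ = √m (e± = (−a±√m)/2, m = a²−4b) over the
DISCRIMINANT field K = ℚ(√m) gives, by Le Fourn 2020 Thm 1.4 P′-form + S-regulator bound +
ramification netting (+ K1a round S-unit frames for unbounded ω), log max ≪ N^ε·N₃(K)·|d_K|^{1/2} ≤
N^ε·rad(b)^{2/3}·rad(m)^{5/6} (all b-primes split in K since m ≡ a² mod p); the 2-ISOGENOUS curve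
[0,−2a,0,m,0] swaps b ↔ m, so the same argument over the TORSION field K′ = ℚ(√b) gives
rad(m)^{2/3}·rad(b)^{5/6} (all m-primes split in K′ since 4b ≡ a² mod q); the minimum of the two is
≤ their geometric mean = rad(bm)^{3/4} (field-choice lemma, kernel-checked in the skeleton
composition). The earlier form (rad(m)^{1/2}·min(rad b, rad m)) over-claimed in the regime rad(m) ≪
rad(b) (e.g. m = −7, the Ramanujan–Nagell family, where it asserted exponent 0⁺ while the method
gives rad(b)^{1/2}); this restatement is exactly what the two-field mechanism delivers and exactly
what the payoff to TwoTorsionClassEpsShape(3/4 -/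
@[route_item "route-ABC-TwoTorsionFieldEconomy", crux (experiment := "instrument: d-nothing 7 · cards 0 · lines 0** · LINE 16 route-ABC-TwoTorsionFieldEconomy REV 1 (idea-2 g2 05:52Z, commit 76401f4905fe): X1 RESTATED 257…") (source := "director LADDER-ABC l.332, 2026-09-01")]
def QuadraticFieldEconomyBound : Prop :=
  ∀ ε : ℝ, 0 < ε → ∃ κ : ℝ, ∀ a b : ℤ, IsCoprime a b → b ≠ 0 → a ^ 2 - 4 * b ≠ 0 → Real.log (max (|(b : ℝ)|) (|(a : ℝ) ^ 2 - 4 * (b : ℝ)|)) ≤ κ * (((UniqueFactorizationMonoid.radical (b * (a ^ 2 - 4 * b))).natAbs : ℕ) : ℝ) ^ (3 / 4 + ε : ℝ)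

-- parent: QuadraticFieldEconomyBound · child (gen 1)
/--     item stmt-ABC-26280 · crux · rank 202 · open
    parent: QuadraticFieldEconomyBound · by planner
    why it might fail: as a statement it fails only if abc fails on 𝒯; as a TARGET OF THIS LINE it has no engine: B-UNIT-HEIGHT-FLOOR puts a polynomial field cost N^{Θ(1)} on every LFL-over-ℚ(√(a²−4b)) frame when ω ≍ log R/loglog R (kit j299838).
    sources: arXiv:1812.06306, arXiv:1901.11289, StewartYu2001, doi:10.4064/aa-74-1-67-80
MANY-PRIMES CORNER = the honest open remainder of X1 (0 seats recommended; abc-implied, ENGINELESS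
by this line): for every δ>0, ε>0 there is κ with log max(|b|,|a²−4b|) ≤ κ·R^{3/4+ε} for all coprime
a,b, b(a²−4b) ≠ 0 with ω(b(a²−4b))·loglog R > δ·log R. Here the unit-height floor (barrier note
B-UNIT-HEIGHT-FLOOR, abc-idea-2 g2: h(η) ≥ ¼·log|d_K| − log 2 for η ∈ ℚ(√d_K)∖ℚ) makes every LFL
frame over the 2-division field cost (c·log|d_K|)^{#split primes} = R^{Θ(1)} (instrument kit
j299838: log ρ/n slope +0.1 per unit n at |d| ≈ 10⁹), so neither print nor K1a reaches it; a
non-Baker input (or a Stewart–Yu-over-K removal of the RATIONAL part of the frame, which would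
shrink the corner to min(ω(b),ω(a²−4b))·loglog R > δ log R) is required. Filed so that X1 =
FewPrimes ∧ ManyPrimes is explicit (dichotomy glue proved locally, v3/ManyPrimes.lean rc 0). -/
@[route_item "route-ABC-TwoTorsionFieldEconomy"]
def ManyPrimesFieldEconomy : Prop :=
  ∀ δ : ℝ, 0 < δ → ∀ ε : ℝ, 0 < ε → ∃ κ : ℝ, ∀ a b : ℤ, IsCoprime a b → b ≠ 0 → a ^ 2 - 4 * b ≠ 0 → δ * Real.log (((UniqueFactorizationMonoid.radical (b * (a ^ 2 - 4 * b))).natAbs : ℕ) : ℝ) < (((b * (a ^ 2 - 4 * b)).natAbs.primeFactors.card : ℕ) : ℝ) * Real.log (Real.log (((UniqueFactorizationMonoid.radical (b * (a ^ 2 - 4 * b))).natAbs : ℕ) : ℝ)) → Real.log (max (|(b : ℝ)|) (|(a : ℝ) ^ 2 - 4 * (b : ℝ)|)) ≤ κ * (((UniqueFactorizationMonoid.radical (b * (a ^ 2 - 4 * b))).natAbs : ℕ) : ℝ) ^ (3 / 4 + ε : ℝ)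

-- parent: QuadraticFieldEconomyBound · child (gen 1)
/--     item stmt-ABC-26279 · support · rank 201 · open
    parent: QuadraticFieldEconomyBound · by planner
    why it might fail: only through typing: the number-field facts (heights on 𝓞_K, S-regulator, Le Fourn's explicit constant) must be rendered; mathematically a corollary of arXiv:1812.06306 Thm 1.4 + arXiv:1901.11289 Lemmas 1–2 + Louboutin.
    sources: arXiv:1812.06306, arXiv:1901.11289, doi:10.4064/aa-74-1-67-80, StewartYu2001
FEW-PRIMES REGIME = what the two-field LFL method PROVABLY delivers (print-level modulo typing; the
BC5 rung of X1): for every ε>0 there are δ>0, κ with log max(|b|,|a²−4b|) ≤ κ·R^{3/4+ε} for all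
coprime a,b, b(a²−4b) ≠ 0, whenever ω(b(a²−4b))·loglog R ≤ δ·log R (R = rad(b(a²−4b))). In this
regime Le Fourn 2020 Thm 1.4's (16ds)^{2(s+3)} (s ≤ 2ω+2 places over K = ℚ(√(a²−4b)) resp. ℚ(√b))
and Bugeaud–Győry 1996's ((s−1)!)²-frame lemma are R^{O(δ)}: NO round-frame input (K1a) is needed;
Louboutin h_K R_K ≤ |d|^{1/2+o(1)} + ramification netting + the two-field geometric mean give 3/4.
Vacuity: pairs with R ≤ e (loglog ≤ 0) are finitely many (b, a²−4b both {2}-smooth and coprime ⇒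
Ramanujan–Nagell-type finiteness), absorbed in κ. -/
@[route_item "route-ABC-TwoTorsionFieldEconomy"]
def FewPrimesFieldEconomy : Prop :=
  ∀ ε : ℝ, 0 < ε → ∃ δ : ℝ, 0 < δ ∧ ∃ κ : ℝ, ∀ a b : ℤ, IsCoprime a b → b ≠ 0 → a ^ 2 - 4 * b ≠ 0 → (((b * (a ^ 2 - 4 * b)).natAbs.primeFactors.card : ℕ) : ℝ) * Real.log (Real.log (((UniqueFactorizationMonoid.radical (b * (a ^ 2 - 4 * b))).natAbs : ℕ) : ℝ)) ≤ δ * Real.log (((UniqueFactorizationMonoid.radical (b * (a ^ 2 - 4 * b))).natAbs : ℕ) : ℝ) → Real.log (max (|(b : ℝ)|) (|(a : ℝ) ^ 2 - 4 * (b : ℝ)|)) ≤ κ * (((UniqueFactorizationMonoid.radical (b * (a ^ 2 - 4 * b))).natAbs : ℕ) : ℝ) ^ (3 / 4 + ε : ℝ)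

-- parent: QuadraticFieldEconomyBound · glue (gen 1)
/--     item stmt-ABC-26281 · support · rank 203 · open
    parent: QuadraticFieldEconomyBound · GLUE: children ⟹ parent · by planner
FewPrimesFieldEconomy → ManyPrimesFieldEconomy → QuadraticFieldEconomyBound: regime dichotomy on
ω(b(a²−4b))·loglog R vs δ(ε)·log R (pure logic; proved sorry-free in the planner's
v3/ManyPrimes.lean: obtain δ from FewPrimes at ε, apply ManyPrimes at (δ, ε), max of the two
constants). -/
@[route_item "route-ABC-TwoTorsionFieldEconomy"]
def QuadraticFieldEconomyBoundGlue : Prop :=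
  FewPrimesFieldEconomy → ManyPrimesFieldEconomy → QuadraticFieldEconomyBound

/-- item stmt-ABC-25770 · crux · rank 3 · open · by planner
why it might fail: it is abc-hard (equivalent to abc given the class theorem); it fails exactly if abc fails — declared residual, not a claim of this line.
sources: PastenShimura2024, Literature.Abc.ABCConjecture
[crux] DECLARED RESIDUAL (abc-strength by construction, never staffed as mathematics of this line):
abc given the class theorem — i.e. abc off (and on) the class beyond exponent 3/4. Booked so that
`closes` reaches the registered Statement decl; to be narrowed to `SzpiroExponentBelowOne` off 𝒯
when that closer is registered. [deps: TwoTorsionClassEpsShape] [difficulty: open-problem] -/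
@[route_item "route-ABC-TwoTorsionFieldEconomy", crux]
def TwoTorsionResidual : Prop :=
  TwoTorsionClassEpsShape → _root_.ABC

/-- item stmt-ABC-25771 · support · rank 9 · open · by planner
sources: Silverman2009, stmt-ABC-23398
[support] BY-NAME support = shared item stmt-ABC-23398 (proved,
`Summit.ABC.ABC.Theorems.twoTorsionDictionary_proof`): for coprime a, b with b(a²−4b) ≠ 0 and W =
[0,a,0,b,0] elliptic: |Δ_min(W)| ≤ |16 b²(a²−4b)| and rad(b(a²−4b)) ∣ 2·N_W (Tate's algorithm away
from 2). [difficulty: provable-now] -/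
@[route_item "route-ABC-TwoTorsionFieldEconomy", crux]
def TwoTorsionDictionary : Prop :=
  ∀ a b : ℤ, IsCoprime a b → b ≠ 0 → a ^ 2 - 4 * b ≠ 0 → ∀ (W : WeierstrassCurve ℚ) [W.IsElliptic], W = ⟨0, (a : ℚ), 0, (b : ℚ), 0⟩ → (W.minimalDiscriminantNorm ℤ : ℝ) ≤ |(16 : ℝ) * (b : ℝ) ^ 2 * ((a : ℝ) ^ 2 - 4 * (b : ℝ))| ∧ (UniqueFactorizationMonoid.radical (b * (a ^ 2 - 4 * b))).natAbs ∣ 2 * W.conductorNorm ℤ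

/-- item stmt-ABC-25772 · support · rank 9 · open · by planner
sources: stmt-ABC-23398, Silverman2009
[support] X1 + dictionary ⇒ target: log|Δ_min| ≤ log 16 + 2 log|b| + log|m| ≤ 3·log max(|b|,|m|) + 3
≤ 3κ·rad(bm)^ε·rad(m)^{1/2}·min(rad b, rad m) + 3, and rad(m)^{1/2}·min(rad b, rad m) ≤ (rad b · rad
m)^{3/4} = rad(bm)^{3/4} (coprimality; two cases rad b ≤ rad m, rad m ≤ rad b), rad(bm) ≤ 2 N_W;
constants absorbed using N_W ≥ 1. Elementary real-analysis bookkeeping (S/M-sized in Lean: rpow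
monotonicity, radical of a coprime product). [difficulty: provable-now] -/
@[route_item "route-ABC-TwoTorsionFieldEconomy", crux]
def FieldEconomyPayoff : Prop :=
  QuadraticFieldEconomyBound → TwoTorsionDictionary → TwoTorsionClassEpsShape

/-- item stmt-ABC-25773 · assembly · rank 1 · open · by planner
sources: stmt-ABC-23398
[assembly] X1 → dictionary → payoff → residual → abc. -/
@[route_item "route-ABC-TwoTorsionFieldEconomy"]
def Assembly : Prop :=
  QuadraticFieldEconomyBound → TwoTorsionDictionary → FieldEconomyPayoff → TwoTorsionResidual → _root_.ABC

/-! D-0027 §2.1 — DECIDING THEOREM (planner-authored via `route open/edit --closes-file`; by planner-abc-idea-2-g2-0 2026-08-28T04:56:10Z):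
its hypotheses are this route's items and its conclusion the sub-problem Statement (glue_lint), and it elaborates with this file. -/

@[closes "route-ABC-TwoTorsionFieldEconomy"] theorem closes (h₁ : QuadraticFieldEconomyBound) (h₂ : TwoTorsionDictionary) (h₃ : FieldEconomyPayoff)
    (h₄ : TwoTorsionResidual) : _root_.ABC := h₄ (h₃ h₁ h₂)

end Summit.ABC.ABC.Theses.TwoTorsionFieldEconomy
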